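import Literature.Analysis.FluidPDE.TypeIAncientMild
import Literature.Analysis.FluidPDE.SelfSimilar
import Summits.NavierStokesRegularity.NavierStokesRegularity.Theorems.SymmetryModuliCountFarPastLedgerReduction
import HarnessLib

/-!
# Route `FilamentSkeletonRss`, crux `RdssProfileTruncation` (stmt-NavierStokesRegularity-11289),
  line `Sketch` — stub `stub_rdssRescale` (normalisation II)

Given a Type-I ancient mild solution `u` in the Oseen gauge (`IsTypeIAncientMild C u`), rotated
discretely self-similar with factor `c` and isometry `R` (`IsRotatedDSS c R u`), with the Type-I
space–time bound `HasTypeIDecay C₀ u`, and a nonzero value `u t₀ x₀ ≠ 0` at some `t₀ < 0`, the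
parabolic rescaling `u' = nsRescale λ u`, `u' t x = λ u(λ² t, λ x)` with `λ = √(−t₀)`, is again in
all three classes with the SAME constants `C`, `(c, R)`, `C₀`, and `u' (−1) (λ⁻¹ x₀) = λ u t₀ x₀ ≠ 0`.

* `IsTypeIAncientMild C` is scale invariant: the tree's `isTypeIAncientMild_nsRescale`
  (`Theorems/SymmetryModuliCountFarPastLedgerReduction`).
* `HasTypeIDecay C₀` is scale invariant: `HasTypeIDecay.nsRescale` (`SelfSimilar`).
* Rotated DSS with the same `(c, R)` is preserved because the scalar rescaling `x ↦ λ x` commutes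
  with `x ↦ c R x` (`R`, `R.symm` are linear): `isRotatedDSS_nsRescale` below.
-/

noncomputable section

open MeasureTheory Set Filter Topology Function
open Literature.Analysis.FluidPDE

set_option linter.dupNamespace false

namespace Summit.NavierStokesRegularity.NavierStokesRegularity.Theorems

/-- Physical space `ℝ³`. -/
local notation "ℝ³" => EuclideanSpace ℝ (Fin 3)

/-- **Rotated discrete self-similarity is preserved by the parabolic rescaling** with any factor
`l : ℝ`: if `c • R⁻¹ u(c² t, c R x) = u(t, x)` for all `t, x`, then the same identity holds for
`nsRescale l u = fun t x => l • u (l² t) (l x)`, because `R (l • x) = l • R x`,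
`R.symm (l • y) = l • R.symm y` and the scalars `c`, `l` commute (Chae–Wolf 2017, Def. 1.1 is
stated modulo the Navier–Stokes scaling). [folklore] -/
theorem isRotatedDSS_nsRescale {c : ℝ} {R : ℝ³ ≃ₗᵢ[ℝ] ℝ³} {u : ℝ → ℝ³ → ℝ³}
    (h : IsRotatedDSS c R u) (l : ℝ) : IsRotatedDSS c R (nsRescale l u) := by
  intro t x
  have key := h (l ^ 2 * t) (l • x)
  simp only [nsRescale_apply]
  rw [← key]
  simp only [LinearIsometryEquiv.map_smul, smul_smul, mul_comm l c, mul_left_comm (l ^ 2) (c ^ 2) t]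

/-- **stub_rdssRescale** (normalisation II).  The parabolic rescaling `u ↦ λ u(λ² ·, λ ·)`,
`λ = √(−t₀)`, preserves the Oseen-gauge Type-I class (same constant), rotated discrete
self-similarity with the same `(c, R)` (scalings commute with `𝒮`), and the Type-I space–time bound,
and moves the nontrivial slice to `t = −1`: `u' (−1) (λ⁻¹ x₀) = λ u t₀ x₀ ≠ 0`. [folklore] -/
theorem stub_rdssRescale :
    ∀ (C C₀ c t₀ : ℝ) (R : ℝ³ ≃ₗᵢ[ℝ] ℝ³) (u : ℝ → ℝ³ → ℝ³) (x₀ : ℝ³),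
      IsTypeIAncientMild C u → IsRotatedDSS c R u → HasTypeIDecay C₀ u → t₀ < 0 → u t₀ x₀ ≠ 0 →
      ∃ (u' : ℝ → ℝ³ → ℝ³) (y₀ : ℝ³), IsTypeIAncientMild C u' ∧ IsRotatedDSS c R u' ∧
        HasTypeIDecay C₀ u' ∧ u' (-1) y₀ ≠ 0 := by
  intro C C₀ c t₀ R u x₀ hK hrdss hdec ht₀ hx₀
  obtain ⟨l, hl, hl2⟩ : ∃ l : ℝ, 0 < l ∧ l ^ 2 = -t₀ :=
    ⟨Real.sqrt (-t₀), Real.sqrt_pos.2 (by linarith), Real.sq_sqrt (by linarith)⟩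
  refine ⟨nsRescale l u, l⁻¹ • x₀, isTypeIAncientMild_nsRescale hK hl,
    isRotatedDSS_nsRescale hrdss l, hdec.nsRescale hl, ?_⟩
  rw [nsRescale_apply, smul_inv_smul₀ hl.ne', show l ^ 2 * (-1) = t₀ by rw [hl2]; ring]
  exact smul_ne_zero hl.ne' hx₀

end Summit.NavierStokesRegularity.NavierStokesRegularity.Theorems
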